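import Summits.NavierStokesRegularity.NavierStokesRegularity.Theorems.ScenarioCensusForward
import Summits.NavierStokesRegularity.NavierStokesRegularity.Theorems.ScenarioCensusForwardAnnex
import Literature.Analysis.FluidPDE.LerayHopf
import Literature.Analysis.FluidPDE.LerayHopfConcatenation
import Literature.Analysis.FluidPDE.LerayHopfRestartEverywhere
import Literature.Analysis.FluidPDE.SteadyLiouvilleTsaiEnergy
import Literature.Analysis.FluidPDE.SereginWangAnnularLiouvilleHolds
import Literature.Analysis.FluidPDE.ChaeTypeIIProfileSteadyLimit
import Mathlib.Analysis.SpecialFunctions.Pow.Deriv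
import Mathlib.Analysis.Calculus.MeanValue
import Literature.Analysis.OperatorTheory.LpDilation
import Mathlib.MeasureTheory.Integral.MeanInequalities
import Literature.Analysis.FunctionSpaces.Mollification
import Literature.Analysis.FluidPDE.LeraySeparationOfEnergyTools
import Mathlib.MeasureTheory.Function.LpSeminorm.CompareExp
import Mathlib.Analysis.SpecialFunctions.NonIntegrable
import Mathlib.MeasureTheory.Measure.Haar.NormedSpace
import HarnessLib.Audit
import HarnessLib

/-!
# Census row D9 (generalized / log-modulated self-similar Type-II blow-up, `λ(t)√(T−t) → ∞`) TYPED — part 1/9: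
# profile-stationary modulations, the rows `Row_D9K` / `Row_D9LH`, the obligation Props S0 / G1 / CORE / G2 and the
# wild residual, the no-Dirichlet `L^q` Liouville lemma (3 < q ≤ 9/2)

Re-homed for the scenario census (typer seat ns-census-typer-1 g7; in scope of the census KEY text «one `def Row_<k> : Prop`
per OPEN row» — row D9 was the one OPEN-NO-LINE row without a typed tree decl, typer-1 g6 HANDOFF 19:50Z; lead programme ended
at v1.67, base SUMMON-only; ANNOUNCE on the cell STATUS 2026-08-28T20:24Z): VERBATIM PORT of ns-idea-9 LINE 16 «modulation_gate»
rev 5, `pub/ideators/ns-idea-9/lines/modulation_gate/modulation_gate.lean` sha16 1d7b2cd493e504e0 (2259 l., lean check rc 0,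
0 sorry; critic idea-crit-8 V66/V67/V69 PASS-WITH-PRICE on rev 1–4, ref ns-census-ref g8 PRE-CHECK ✓ §13.14 [5/6] of rev 4
f704279be2039922; rev 5 = rev 4 + §6e «S0 proved»; TARGET-MENU r4 names this line as row D9's lever; CENSUS-FINAL r6 §2 lists
`row_F4bp_of_row_D9K` / `row_F4bpLH_of_row_D9LH` as FILES-ONLY edges), split for the 400-line rule into
`ScenarioCensusRowD9Modulation` (§1–§4) → `…RowD9Kernel` (§5) → `…RowD9PowerLaw` (§6) → `…RowD9CoreExponents` (§6c (i)–(iv)) →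
`…RowD9Core` (§6c (v)) → `…RowD9DissipationTools` (§6d, first half) → `…RowD9Dissipation` (§6d, second half) →
`…RowD9SteadyLimitTools` (§6e, first half) → `…RowD9` (§6e, second half; §7; census KEYS).  Lean text VERBATIM in namespace
`…Theorems.ScenarioCensus.ModulationGate` (the line's `…Cruxes.Row_F4bp.ModulationGate` re-homed); port edits: the two
`local notation "E3"` lines → `abbrev E3` (typer lint: no notation in port files), `@[conjecture]` added to the four OPEN
parameterless `def`s `Row_D9K` / `Row_D9LH` / `Row_D9LHWild` / `Row_F4bpLH` (obligation nodes), one-line docstrings added to twelve undocumented auxiliaries, the three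
`@[deprecated] stub_*` aliases of §7 not re-declared, four §7 docstrings updated to the rev-5 facts (everything proved).

No census value is asserted here (a summoned lead books row D9; FILES-ONLY edges become TREE by name); NS regularity is NOT
proved; rows D9 / F4b′ stay OPEN (= their wild residuals, by theorem); no summit statement is proved by this file.
-/

-- the summit and its single problem share the name `NavierStokesRegularity` (D-0017 nested layout)
set_option linter.dupNamespace false

noncomputable section

open Set Function Filter Topology MeasureTheory Metric
open scoped NNReal ENNReal ContDiff

namespace Summit.NavierStokesRegularity.NavierStokesRegularity.Theorems.ScenarioCensus.ModulationGate

open Literature.Analysis Literature.Analysis.FluidPDE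
open Summit.NavierStokesRegularity.NavierStokesRegularity.Theorems.ScenarioCensus

/-! ## §1 Profile-stationary modulations and the modulated deviation -/

/-- **Profile-stationary modulation** near the blow-up time `T`: `λ(t) → ∞` as `t ↑ T`, and
`μ := λ⁻²` is differentiable near `T` with `μ′(t) → 0` (Chae's generalized self-similar transform,
arXiv:0711.1113 (2.1)–(2.3) with `α = 1`: in the variables `y = λx`, `ds = λ²dt`, `v = λV(λx,s)` the profile
equation reads `V_s + (V·∇)V − ΔV + ∇P = (μ′/2)[V + (y·∇)V]`; the drift vanishes in the limit iff the
modulation is stationary).  `μ′ → 0` with `μ(T⁻) = 0` forces `μ(t) = o(T − t)`, i.e. `λ(t)√(T−t) → ∞`: Type II. [cite: Chae2010, arXiv:0711.1113 §2 (2.1)–(2.3) (generalized self-similar transform)] -/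
structure IsStationaryModulation (T : ℝ) (lam : ℝ → ℝ) : Prop where
  tendsto_atTop : Tendsto lam (𝓝[<] T) atTop
  stationary : ∃ μ' : ℝ → ℝ,
    (∀ᶠ t in 𝓝[<] T, HasDerivAt (fun s => ((lam s) ^ 2)⁻¹) (μ' t) t) ∧ Tendsto μ' (𝓝[<] T) (𝓝 0)

/-- Chae's power-law modulation `λ(t) = (T−t)^{−γ/2}` (Type II iff `γ > 1`; `γ = 1` is Leray's rate). -/
def chaeModulation (T γ : ℝ) (t : ℝ) : ℝ := ((T - t) ^ (γ / 2))⁻¹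

/-- The modulated self-similar field `λ(t) V̄(λ(t) x)`. -/
def modulatedField (lam : ℝ → ℝ) (V : EuclideanSpace ℝ (Fin 3) → EuclideanSpace ℝ (Fin 3)) (t : ℝ)
    (x : EuclideanSpace ℝ (Fin 3)) : EuclideanSpace ℝ (Fin 3) :=
  lam t • V (lam t • x)

/-- **Chae's relative `L^p` deviation for a general modulation**:
`λ(t)^{3/p − 1} ‖v(t) − λ(t)V̄(λ(t)·)‖_{L^p}` (`= ‖W(t) − V̄‖_p` for the zoom `W(y,t) = λ⁻¹v(y/λ,t)`).
For `λ = (T−t)^{−γ/2}` it IS `chaeTypeIIDeviation T γ p v V̄` (for `t < T`: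
`modulatedDeviation_chae`). [cite: Chae2010, Thm 1.4 (the displayed hypothesis), arXiv:0711.1113 (2.16)] -/
def modulatedDeviation (lam : ℝ → ℝ) (p : ℝ≥0)
    (v : ℝ → EuclideanSpace ℝ (Fin 3) → EuclideanSpace ℝ (Fin 3))
    (V : EuclideanSpace ℝ (Fin 3) → EuclideanSpace ℝ (Fin 3)) (t : ℝ) : ℝ≥0∞ :=
  ENNReal.ofReal ((lam t) ^ (3 / (p : ℝ) - 1)) *
    eLpNorm (fun x => v t x - lam t • V (lam t • x)) (p : ℝ≥0∞) volume

/-- **The zoom-gate quantity** `λ(t)^{−3/(2p)} ‖v(t) − λV̄(λ·)‖_{L^p}` (LINE 15's `rateGateQuantity`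
for a general modulation: `= λ^{β_p}·(relative deviation)`, `β_p = 1 − 9/(2p)`). -/
def zoomGateQuantity (lam : ℝ → ℝ) (p : ℝ≥0)
    (v : ℝ → EuclideanSpace ℝ (Fin 3) → EuclideanSpace ℝ (Fin 3))
    (V : EuclideanSpace ℝ (Fin 3) → EuclideanSpace ℝ (Fin 3)) (t : ℝ) : ℝ≥0∞ :=
  ENNReal.ofReal ((lam t) ^ (-(3 / (2 * (p : ℝ))))) *
    eLpNorm (fun x => v t x - lam t • V (lam t • x)) (p : ℝ≥0∞) volume

/-! ## §2 The rows (census D9 typed in the two frames) -/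

/-- **Row D9 in Chae's (Kato) frame.**  A Kato-class classical solution on `(0,T)` that is
asymptotically self-similar in `L^p` (`p > 3`) under a profile-stationary modulation, with profile
`V̄ ∈ Ḣ¹ ∩ L^p`, has `V̄ = 0`.  Its power-law member (`λ = (T−t)^{−γ/2}`, `γ > 1`, `p > 9/2`) is the
census row F4b′ (`row_F4bp_of_row_D9K`).  OPEN (for `p > 9/2` it contains F4b′; for `3 < p ≤ 9/2` it
holds given S0: `row_D9Sharp_of_S0`). [cite: Chae2010, Thm 1.4 and arXiv:0711.1113 §2 (modulated transform)] -/
@[conjecture] def Row_D9K : Prop :=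
  ∀ (T : ℝ), 0 < T → ∀ (p : ℝ≥0), (3 : ℝ≥0∞) < (p : ℝ≥0∞) →
    ∀ (v : ℝ → EuclideanSpace ℝ (Fin 3) → EuclideanSpace ℝ (Fin 3))
      (π : ℝ → EuclideanSpace ℝ (Fin 3) → ℝ),
    IsClassicalNSSolutionOn (Ioo 0 T) 1 0 v π → ContinuousInLpOn (Ico 0 T) p v →
    ∀ (lam : ℝ → ℝ), IsStationaryModulation T lam →
    ∀ (V : EuclideanSpace ℝ (Fin 3) → EuclideanSpace ℝ (Fin 3)),
    MemLp V (p : ℝ≥0∞) volume → Tendsto (modulatedDeviation lam p v V) (𝓝[<] T) (𝓝 0) →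
    eWeakGradL2Sq V < ⊤ → V =ᵐ[volume] 0

/-- **Row D9 in the census's forward = Leray–Hopf frame** (classical on `[0,T)`, Leray–Hopf from the
datum; as `Row_D9aLH`).  OPEN; reduced below to `Row_D9LHWild` given S0, G1 and the CORE. -/
@[conjecture] def Row_D9LH : Prop :=
  ∀ (T : ℝ), 0 < T → ∀ (p : ℝ≥0), (3 : ℝ≥0∞) < (p : ℝ≥0∞) →
    ∀ (v : ℝ → EuclideanSpace ℝ (Fin 3) → EuclideanSpace ℝ (Fin 3))
      (π : ℝ → EuclideanSpace ℝ (Fin 3) → ℝ),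
    IsClassicalNSSolutionOn (Ico 0 T) 1 0 v π → IsLerayHopfOn T 1 0 (v 0) v →
    ∀ (lam : ℝ → ℝ), IsStationaryModulation T lam →
    ∀ (V : EuclideanSpace ℝ (Fin 3) → EuclideanSpace ℝ (Fin 3)),
    MemLp V (p : ℝ≥0∞) volume → Tendsto (modulatedDeviation lam p v V) (𝓝[<] T) (𝓝 0) →
    eWeakGradL2Sq V < ⊤ → V =ᵐ[volume] 0

/-! ## §3 Obligation Props: S0 (modulated steady limit), G1 (dissipation gate), CORE (zoom distance),
G2 (rate gate — derived), and the residual -/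

/-- **S0 — the modulated steady limit** (obligation Prop; **PROVED**: `modulatedSteadyLimit_holds'`, §6e, rev 5).  Chae's step
«V̄ is a stationary solution» for a profile-stationary modulation: the `L^p` profile (`p > 3`) of a
classical solution on `(0,T)` is a.e. equal to a smooth steady NS solution (`ν = 1`, no force).  The
power law is the tree theorem `typeII_profile_ae_eq_steadyClassicalNS`; the port replaces the windows
`(t₀ − (T−t₀)^γ, t₀)` by `(t₀ − μ(t₀), t₀)` and `(1 + (T−t₀)^{γ−1})^{−γ/2} → 1` by `μ′ → 0`.  Why it
might fail: only if `μ′ → 0` is too weak to make `λ(t)/λ(t₀) → 1` UNIFORMLY on the window — it is not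
(mean value theorem: `|μ(t) − μ(t₀)| ≤ sup|μ′|·μ(t₀)` on a window of length `μ(t₀)`). Size L (port). -/
def ModulatedSteadyLimit : Prop :=
  ∀ (T : ℝ), 0 < T → ∀ (p : ℝ≥0), 3 < p →
    ∀ (v : ℝ → EuclideanSpace ℝ (Fin 3) → EuclideanSpace ℝ (Fin 3))
      (π : ℝ → EuclideanSpace ℝ (Fin 3) → ℝ),
    IsClassicalNSSolutionOn (Ioo 0 T) 1 0 v π →
    ∀ (lam : ℝ → ℝ), IsStationaryModulation T lam →
    ∀ (V : EuclideanSpace ℝ (Fin 3) → EuclideanSpace ℝ (Fin 3)),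
    MemLp V (p : ℝ≥0∞) volume → Tendsto (modulatedDeviation lam p v V) (𝓝[<] T) (𝓝 0) →
    ∃ (U : EuclideanSpace ℝ (Fin 3) → EuclideanSpace ℝ (Fin 3)) (P : EuclideanSpace ℝ (Fin 3) → ℝ),
      IsSteadyClassicalNS 1 0 U P ∧ V =ᵐ[volume] U

/-- **G1 — the modulated DISSIPATION GATE** (obligation Prop; **PROVED**: `modulatedDissipationGate_holds'`, §6d, rev 4).
Classical Leray–Hopf on `[0,T)`, any `p ≥ 2`, a stationary modulation with NON-INTEGRABLE speed
`∫_{T−ε}^{T} λ(t) dt = ∞` (power laws: `γ ≥ 2`), `L^p` profile with relative convergence ⇒ `V̄ = 0`.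
Route: `∫₀^T λ(t)‖∇W(t)‖₂² dt = ∫₀^T‖∇v‖₂² ≤ ½‖v₀‖₂²` forces `liminf‖∇W(t)‖₂ = 0`; `W(tₙ) → V̄` in
`L^p` ⇒ weak gradient `0` ⇒ `V̄` a.e. constant, in `L^p` ⇒ `0`.  Uses only `tendsto_atTop` of the
modulation.  Why it might fail: typing only (the weak gradient of the LH structure is `fderiv ℝ (v t)`
for a.e. `t`: `hasWeakGradient_fderiv_of_contDiff` + a.e. uniqueness). Size M. -/
def ModulatedDissipationGate : Prop :=
  ∀ (T : ℝ), 0 < T → ∀ (p : ℝ≥0), 2 ≤ p →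
    ∀ (v : ℝ → EuclideanSpace ℝ (Fin 3) → EuclideanSpace ℝ (Fin 3))
      (π : ℝ → EuclideanSpace ℝ (Fin 3) → ℝ),
    IsClassicalNSSolutionOn (Ico 0 T) 1 0 v π → IsLerayHopfOn T 1 0 (v 0) v →
    ∀ (lam : ℝ → ℝ), IsStationaryModulation T lam →
    (∀ ε : ℝ, 0 < ε → ε < T → ∫⁻ t in Ioo (T - ε) T, ENNReal.ofReal (lam t) = ⊤) →
    ∀ (V : EuclideanSpace ℝ (Fin 3) → EuclideanSpace ℝ (Fin 3)),
    MemLp V (p : ℝ≥0∞) volume → Tendsto (modulatedDeviation lam p v V) (𝓝[<] T) (𝓝 0) →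
    V =ᵐ[volume] 0

/-- **CORE — steady solutions are quantitatively far from the energy ball under zoom** (obligation
Prop; `stub_steadyZoomDistance`; TIME-FREE).  Let `U` be a smooth steady NS solution (`ν = 1`, no force),
`V̄ =ᵐ U`, `V̄ ∈ L^p`, `p > 3`, `U ≠ 0`, and `M < ∞`.  Then there is `c > 0` such that for all large `L`
and every (a.e.-strongly) MEASURABLE `w` with `‖w‖_{L²} ≤ M`: `c ≤ L^{−3/(2p)} ‖w − L V̄(L·)‖_{L^p}`.
(The measurability binder is load-bearing: Mathlib's `eLpNorm` is a LOWER integral, and for a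
non-measurable `w = L V̄(L·)·1_{Sᶜ}`, `S` a Bernstein set, both `‖w‖₂` and `‖w − LV̄(L·)‖_p` vanish; without
the binder the Prop would silently assert the Liouville theorem "no nonzero smooth steady `U ∈ L^p`".)
Route (card §Numbers):
`‖U‖_{L²(B_{2R})} ≤ L^{1/2} M + |B_{2R}|^{1/2−1/p} L^{1−3/p}·(L^{3/p−1}‖w − LV̄(L·)‖_p)` (energy
transported to the profile scale) against `‖U‖²_{L²(A_R)} ≥ c_U R^{(p−2)/(p−3)}` for large `R` (Tsai 2021
Thm 1.1 (a), `δ = 0`, tree theorem `Tsai2021_annular_liouville_holds`, + Hölder), optimised in `R`.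
Why it might fail: an exponent slip only — `3/(2p)` is what the optimisation gives
(`(b−a)/(2a) = 1 − 9/(2p)` with `a = (p−2)/(2(p−3))`, `b = 3(p−2)/(2p)`). Size M/L. -/
def SteadyZoomDistance : Prop :=
  ∀ (U V : EuclideanSpace ℝ (Fin 3) → EuclideanSpace ℝ (Fin 3)) (P : EuclideanSpace ℝ (Fin 3) → ℝ),
    IsSteadyClassicalNS 1 0 U P → V =ᵐ[volume] U →
    ∀ (p : ℝ≥0), 3 < p → MemLp V (p : ℝ≥0∞) volume → U ≠ 0 →
    ∀ (M : ℝ≥0∞), M ≠ ⊤ → ∃ c : ℝ≥0∞, c ≠ 0 ∧ ∀ᶠ L : ℝ in atTop,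
      ∀ (w : EuclideanSpace ℝ (Fin 3) → EuclideanSpace ℝ (Fin 3)), AEStronglyMeasurable w volume →
        eLpNorm w 2 volume ≤ M →
        c ≤ ENNReal.ofReal (L ^ (-(3 / (2 * (p : ℝ))))) *
          eLpNorm (fun x => w x - L • V (L • x)) (p : ℝ≥0∞) volume

/-- **G2 — the modulated RATE GATE** (DERIVED: `modulatedRateGate_of_core`).  Classical Leray–Hopf on
`[0,T)`, `p > 3`, stationary modulation, `L^p` profile with relative convergence, and the remainder tame
along a sequence `liminf_{t↑T} λ^{−3/(2p)}‖v(t) − λV̄(λ·)‖_p = 0` ⇒ `V̄ = 0` a.e. -/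
def ModulatedRateGate : Prop :=
  ∀ (T : ℝ), 0 < T → ∀ (p : ℝ≥0), (3 : ℝ≥0∞) < (p : ℝ≥0∞) →
    ∀ (v : ℝ → EuclideanSpace ℝ (Fin 3) → EuclideanSpace ℝ (Fin 3))
      (π : ℝ → EuclideanSpace ℝ (Fin 3) → ℝ),
    IsClassicalNSSolutionOn (Ico 0 T) 1 0 v π → IsLerayHopfOn T 1 0 (v 0) v →
    ∀ (lam : ℝ → ℝ), IsStationaryModulation T lam →
    ∀ (V : EuclideanSpace ℝ (Fin 3) → EuclideanSpace ℝ (Fin 3)),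
    MemLp V (p : ℝ≥0∞) volume → Tendsto (modulatedDeviation lam p v V) (𝓝[<] T) (𝓝 0) →
    liminf (zoomGateQuantity lam p v V) (𝓝[<] T) = 0 → V =ᵐ[volume] 0

/-- **The WILD residual of row D9 (LH frame)** — the weakest unknown consequence, typed: `p > 9/2`,
INTEGRABLE modulation speed near `T` (`∫_{T−ε}^T λ < ∞` for some `ε`; power laws: `γ < 2`), UNTAMED
remainder `liminf λ^{−3/(2p)}‖v(t) − λV̄(λ·)‖_p ≠ 0`, Chae's `V̄ ∈ Ḣ¹`.  OPEN; implied by the S1 wall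
given S0 (`row_D9LHWild_of_core_of_steady`). -/
@[conjecture] def Row_D9LHWild : Prop :=
  ∀ (T : ℝ), 0 < T → ∀ (p : ℝ≥0), (9 / 2 : ℝ≥0∞) < (p : ℝ≥0∞) →
    ∀ (v : ℝ → EuclideanSpace ℝ (Fin 3) → EuclideanSpace ℝ (Fin 3))
      (π : ℝ → EuclideanSpace ℝ (Fin 3) → ℝ),
    IsClassicalNSSolutionOn (Ico 0 T) 1 0 v π → IsLerayHopfOn T 1 0 (v 0) v →
    ∀ (lam : ℝ → ℝ), IsStationaryModulation T lam →
    (∃ ε : ℝ, 0 < ε ∧ ε < T ∧ ∫⁻ t in Ioo (T - ε) T, ENNReal.ofReal (lam t) < ⊤) →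
    ∀ (V : EuclideanSpace ℝ (Fin 3) → EuclideanSpace ℝ (Fin 3)),
    MemLp V (p : ℝ≥0∞) volume → Tendsto (modulatedDeviation lam p v V) (𝓝[<] T) (𝓝 0) →
    liminf (zoomGateQuantity lam p v V) (𝓝[<] T) ≠ 0 →
    eWeakGradL2Sq V < ⊤ → V =ᵐ[volume] 0

/-! ## §4 The no-Dirichlet `L^q` Liouville lemma (3 < q ≤ 9/2) — verbatim from LINE 15, PROVED -/

section Rung

/-- Tails of a finite integral over the far regions `{R ≤ |x|}` vanish as `R → ∞`. [folklore] -/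
theorem tendsto_setLIntegral_far_zero
    {U : EuclideanSpace ℝ (Fin 3) → EuclideanSpace ℝ (Fin 3)} {q : ℝ}
    (hfin : ∫⁻ x, ‖U x‖ₑ ^ q < ⊤) :
    Tendsto (fun R : ℝ => ∫⁻ x in {x | R ≤ ‖x‖}, ‖U x‖ₑ ^ q) atTop (𝓝 0) := by
  set μ' : Measure (EuclideanSpace ℝ (Fin 3)) := volume.withDensity (fun x => ‖U x‖ₑ ^ q)
    with hμ'
  have hmeas : ∀ R : ℝ, MeasurableSet {x : EuclideanSpace ℝ (Fin 3) | R ≤ ‖x‖} :=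
    fun R => measurableSet_le measurable_const measurable_norm
  have hanti : Antitone (fun R : ℝ => {x : EuclideanSpace ℝ (Fin 3) | R ≤ ‖x‖}) :=
    fun R₁ R₂ h x (hx : R₂ ≤ ‖x‖) => le_trans h hx
  have hfin' : ∃ R : ℝ, μ' {x | R ≤ ‖x‖} ≠ ⊤ := by
    refine ⟨0, ne_of_lt ?_⟩
    rw [hμ', withDensity_apply _ (hmeas 0)]
    exact lt_of_le_of_lt (setLIntegral_le_lintegral _ _) hfin
  have hlim := tendsto_measure_iInter_atTop (μ := μ')
    (fun R => (hmeas R).nullMeasurableSet) hanti hfin'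
  have hempty : (⋂ R : ℝ, {x : EuclideanSpace ℝ (Fin 3) | R ≤ ‖x‖}) = ∅ := by
    ext x
    simp only [mem_iInter, mem_setOf_eq, mem_empty_iff_false, iff_false, not_forall, not_le]
    exact ⟨‖x‖ + 1, by linarith⟩
  rw [hempty, measure_empty] at hlim
  refine hlim.congr fun R => ?_
  show μ' {x | R ≤ ‖x‖} = _
  rw [hμ', withDensity_apply _ (hmeas R)]

/-- **Steady Liouville in `L^q`, `3 < q ≤ 9/2`, NO gradient / decay hypothesis** (corollary of
Seregin–Wang 2020 Thm 1.1 (i), tree theorem). [cite: SereginWang2020, Thm 1.1 (i) + Remark 1.2 (i)] -/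
theorem steady_eq_zero_of_memLp_superThree
    {U : EuclideanSpace ℝ (Fin 3) → EuclideanSpace ℝ (Fin 3)} {P : EuclideanSpace ℝ (Fin 3) → ℝ}
    (hUP : IsSteadyClassicalNS 1 0 U P) {q : ℝ≥0} (hq3 : 3 < q) (hq92 : (q : ℝ≥0∞) ≤ 9 / 2)
    (hUq : MemLp U (q : ℝ≥0∞) volume) : U = 0 := by
  have hqr3 : (3 : ℝ) < (q : ℝ) := by exact_mod_cast hq3
  have hqr0 : (0 : ℝ) < (q : ℝ) := lt_trans (by norm_num) hqr3
  have hq0 : (q : ℝ≥0∞) ≠ 0 := by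
    have : (q : ℝ≥0) ≠ 0 := by
      intro h; rw [h] at hq3; exact absurd hq3 (by norm_num)
    exact_mod_cast this
  have hq92' : (q : ℝ≥0) ≤ 9 / 2 := by
    have h : ((q : ℝ≥0) : ℝ≥0∞) ≤ ((9 / 2 : ℝ≥0) : ℝ≥0∞) := by
      rw [ENNReal.coe_div (by norm_num), ENNReal.coe_ofNat, ENNReal.coe_ofNat]; exact hq92
    exact_mod_cast h
  have hq92r : (q : ℝ) ≤ 9 / 2 := by exact_mod_cast hq92'
  have hfin : ∫⁻ x, ‖U x‖ₑ ^ (q : ℝ) < ⊤ := by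
    have := lintegral_rpow_enorm_lt_top_of_eLpNorm_lt_top hq0 ENNReal.coe_ne_top hUq.eLpNorm_lt_top
    simpa only [ENNReal.coe_toReal] using this
  have htail2 : Tendsto (fun R : ℝ => ∫⁻ x in {x | R / 2 ≤ ‖x‖}, ‖U x‖ₑ ^ (q : ℝ)) atTop (𝓝 0) :=
    (tendsto_setLIntegral_far_zero hfin).comp (tendsto_id.atTop_div_const (by norm_num : (0:ℝ) < 2))
  have hroot : Tendsto (fun R : ℝ =>
      (∫⁻ x in {x | R / 2 ≤ ‖x‖}, ‖U x‖ₑ ^ (q : ℝ)) ^ (1 / (q : ℝ))) atTop (𝓝 0) := by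
    have hc := (ENNReal.continuous_rpow_const (y := 1 / (q : ℝ))).tendsto (0 : ℝ≥0∞)
    rw [ENNReal.zero_rpow_of_pos (by positivity)] at hc
    exact hc.comp htail2
  have hM : Tendsto (annularMorrey (q : ℝ) U) atTop (𝓝 0) := by
    refine tendsto_of_tendsto_of_tendsto_of_le_of_le' tendsto_const_nhds hroot
      (Eventually.of_forall fun R => bot_le) ?_
    filter_upwards [eventually_ge_atTop (1 : ℝ)] with R hR
    have h1 : ENNReal.ofReal (R ^ (2 / 3 - 3 / (q : ℝ))) ≤ 1 := by
      rw [← ENNReal.ofReal_one]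
      refine ENNReal.ofReal_le_ofReal (Real.rpow_le_one_of_one_le_of_nonpos hR ?_)
      rw [sub_nonpos, div_le_div_iff₀ (by norm_num) hqr0]
      linarith
    have h2 : (∫⁻ x in ball (0 : EuclideanSpace ℝ (Fin 3)) R \ ball 0 (R / 2), ‖U x‖ₑ ^ (q : ℝ))
        ≤ ∫⁻ x in {x | R / 2 ≤ ‖x‖}, ‖U x‖ₑ ^ (q : ℝ) := by
      refine lintegral_mono_set fun x hx => ?_
      have hx2 : x ∉ ball (0 : EuclideanSpace ℝ (Fin 3)) (R / 2) := hx.2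
      rw [Metric.mem_ball, dist_zero_right, not_lt] at hx2
      exact hx2
    calc annularMorrey (q : ℝ) U R
        = ENNReal.ofReal (R ^ (2 / 3 - 3 / (q : ℝ))) *
            (∫⁻ x in ball (0 : EuclideanSpace ℝ (Fin 3)) R \ ball 0 (R / 2), ‖U x‖ₑ ^ (q : ℝ))
              ^ (1 / (q : ℝ)) := rfl
      _ ≤ 1 * (∫⁻ x in {x | R / 2 ≤ ‖x‖}, ‖U x‖ₑ ^ (q : ℝ)) ^ (1 / (q : ℝ)) :=
          mul_le_mul' h1 (ENNReal.rpow_le_rpow h2 (by positivity))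
      _ = _ := one_mul _
  exact SereginWang2020_annular_liouville_holds.of_liminf_eq_zero one_pos hqr3
    hUP.isLerayProfile_zero hUP.smooth_velocity hUP.smooth_pressure hM.liminf_eq

end Rung

end Summit.NavierStokesRegularity.NavierStokesRegularity.Theorems.ScenarioCensus.ModulationGate

end
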